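import Summits.Parity.GeneralizedHardyLittlewood.Theorems.PrimeLevelFamEdgeMomentsBeyondDiagonalDiagBoseMixedProfile
import Summits.Parity.GeneralizedHardyLittlewood.Theorems.PrimeLevelFamEdgeMomentsBeyondDiagonalDiagBoseMixedShell
import Mathlib.Analysis.SpecialFunctions.Integrals.Basic
import HarnessLib

/-!
# Route `PrimeLevelFamEdge`, crux K_A `MomentsBeyondDiagonal` (stmt-Parity-20007), line «petersson_layers» v4, stub `stub_diag`:
# **census R2 — the model polynomial and the REMAINDER of the Bose coefficients (smallness and bounded variation)**

With the shell identity (`…DiagBoseMixedShell`, p819467) and the one-variable profile estimate (`…DiagBoseMixedProfile`: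
`η·I_ab(η) = m_ab(η) + ρ_ab(η)`, `m_ab(η) = ∫₀¹S_ab(L_η, log v)v/(1+v²)²dv`, `|ρ_ab(η)| ≤ C₁η(1+L_η)^{a+b+1}`, `L_η = log(1/η)`):

* `shellS_expand` / `shell_model_expand` — `m_ab(η) = Σ_{i≤a,j≤b} C(a,i)C(b,j)((−1)^j+(−1)^i) μ_{i+j}·(−L_η/2)^{a−i}(−L_η/2)^{b−j}`,
  `μ_k = ∫₀¹(log v)^k v/(1+v²)² dv` — an explicit polynomial of degree `a+b` in `L_η`;
* `abs_integral_shell_rem_le` — **`|∫_{y₁<η≤y₂} ρ_ab(η)dη/η| ≤ C₁(y₂−y₁)(1+L_{y₁})^{a+b+1}`** (`0<y₁≤y₂≤1`; bounded variation);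
* `abs_integral_shell_rem_small_le` — **`|∫_{0<η≤y} ρ_ab(η)dη/η| ≤ C·y·(1+L_y)^{a+b+1}`** (`0<y≤1`; smallness);
(The assembly `c_ab = c_ab(1) + A_ab + polynomial − R_ab` is `…DiagBoseMixedStructure.bose_coeff_structure`.)

Def-free; theorems only. Helper `--supports stmt-Parity-20007`; closes nothing; K_A, K_B and the Parity summit are NOT
proved; nothing about Landau–Siegel zeros.

## References
* E. Kowalski, P. Michel, J. VanderKam, J. reine angew. Math. 526 (2000), (22)–(28) pp. 12–15.
  [cite: KowalskiMichelVanderKam2000, (22)–(28) — derivation (residues of the diagonal weight, real-variable form)]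
-/

noncomputable section

open Real Set MeasureTheory Filter Function Finset

namespace Summit.Parity.GeneralizedHardyLittlewood.Theorems.MomentsBeyondDiagonal.DiagLines

/-! ## §1. The model is an explicit polynomial in `L` -/

/-- Binomial expansion of the symmetrised weight `S_ab(L,x)`. [folklore] -/
theorem shellS_expand (L x : ℝ) (a b : ℕ) :
    (-(L / 2) + x) ^ a * (-(L / 2) - x) ^ b + (-(L / 2) - x) ^ a * (-(L / 2) + x) ^ b =
      ∑ i ∈ Finset.range (a + 1), ∑ j ∈ Finset.range (b + 1),
        (a.choose i : ℝ) * (b.choose j : ℝ) * ((-1) ^ j + (-1) ^ i) * (-(L / 2)) ^ (a - i) * (-(L / 2)) ^ (b - j) *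
          x ^ (i + j) := by
  have e1 : -(L / 2) + x = x + -(L / 2) := by ring
  have e2 : -(L / 2) - x = -x + -(L / 2) := by ring
  rw [e1, e2, add_pow x (-(L / 2)) a, add_pow (-x) (-(L / 2)) b, add_pow (-x) (-(L / 2)) a,
    add_pow x (-(L / 2)) b, Finset.sum_mul_sum, Finset.sum_mul_sum, ← Finset.sum_add_distrib]
  refine Finset.sum_congr rfl fun i _ ↦ ?_
  rw [← Finset.sum_add_distrib]
  refine Finset.sum_congr rfl fun j _ ↦ ?_
  rw [neg_pow x, neg_pow x, pow_add]
  ring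

/-- `(log v)^k · v/(1+v²)²` is integrable on `(0, 1]`. [folklore] -/
theorem integrableOn_log_pow_mul_model (k : ℕ) :
    IntegrableOn (fun v : ℝ ↦ Real.log v ^ k * (v / (1 + v ^ 2) ^ 2)) (Ioc 0 1) := by
  have hJ := (integrableOn_one_add_abs_log_pow_div_sq k).mono_set (Ioc_subset_Ioi_self : Ioc (0 : ℝ) 1 ⊆ Ioi 0)
  refine Integrable.mono' (hJ.const_mul 4) ?_ ?_
  · exact ((Real.measurable_log.pow_const k).mul
      (measurable_id.div ((measurable_const.add (measurable_id.pow_const 2)).pow_const 2))).aestronglyMeasurable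
  · rw [ae_restrict_iff' measurableSet_Ioc]
    refine ae_of_all _ fun v hv ↦ ?_
    have hv0 : 0 < v := hv.1
    rw [Real.norm_eq_abs, abs_mul, abs_pow, abs_of_nonneg (by positivity : (0 : ℝ) ≤ v / (1 + v ^ 2) ^ 2)]
    have h1 : |Real.log v| ^ k ≤ (1 + |Real.log v|) ^ k :=
      pow_le_pow_left₀ (abs_nonneg _) (by linarith [abs_nonneg (Real.log v)]) k
    calc |Real.log v| ^ k * (v / (1 + v ^ 2) ^ 2) ≤ (1 + |Real.log v|) ^ k * (4 / (1 + v) ^ 2) :=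
          mul_le_mul h1 (model_weight_le hv0) (by positivity) (by positivity)
      _ = 4 * ((1 + |Real.log v|) ^ k / (1 + v) ^ 2) := by ring

/-- **The model integral is an explicit polynomial in `L`.** For every real `L`:
`∫_{0<v≤1} S_ab(L, log v)·v/(1+v²)² dv = Σ_{i≤a,j≤b} C(a,i)C(b,j)((−1)^j+(−1)^i)(−L/2)^{a−i}(−L/2)^{b−j}·μ_{i+j}`,
`μ_k = ∫_{0<v≤1}(log v)^k v/(1+v²)² dv`. [folklore] -/
theorem shell_model_expand (L : ℝ) (a b : ℕ) :
    ∫ v in Ioc (0 : ℝ) 1, ((-(L / 2) + Real.log v) ^ a * (-(L / 2) - Real.log v) ^ b +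
        (-(L / 2) - Real.log v) ^ a * (-(L / 2) + Real.log v) ^ b) * (v / (1 + v ^ 2) ^ 2) =
      ∑ i ∈ Finset.range (a + 1), ∑ j ∈ Finset.range (b + 1),
        (a.choose i : ℝ) * (b.choose j : ℝ) * ((-1) ^ j + (-1) ^ i) * (-(L / 2)) ^ (a - i) * (-(L / 2)) ^ (b - j) *
          ∫ v in Ioc (0 : ℝ) 1, Real.log v ^ (i + j) * (v / (1 + v ^ 2) ^ 2) := by
  have hptw : ∀ v ∈ Ioc (0 : ℝ) 1, ((-(L / 2) + Real.log v) ^ a * (-(L / 2) - Real.log v) ^ b +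
        (-(L / 2) - Real.log v) ^ a * (-(L / 2) + Real.log v) ^ b) * (v / (1 + v ^ 2) ^ 2) =
      ∑ i ∈ Finset.range (a + 1), ∑ j ∈ Finset.range (b + 1),
        (a.choose i : ℝ) * (b.choose j : ℝ) * ((-1) ^ j + (-1) ^ i) * (-(L / 2)) ^ (a - i) * (-(L / 2)) ^ (b - j) *
          (Real.log v ^ (i + j) * (v / (1 + v ^ 2) ^ 2)) := by
    intro v _
    rw [shellS_expand, Finset.sum_mul]
    refine Finset.sum_congr rfl fun i _ ↦ ?_
    rw [Finset.sum_mul]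
    refine Finset.sum_congr rfl fun j _ ↦ ?_
    ring
  rw [setIntegral_congr_fun measurableSet_Ioc hptw,
    integral_finsetSum _ fun i _ ↦ integrable_finsetSum _ fun j _ ↦
      ((integrableOn_log_pow_mul_model (i + j)).const_mul _)]
  refine Finset.sum_congr rfl fun i _ ↦ ?_
  rw [integral_finsetSum _ fun j _ ↦ (integrableOn_log_pow_mul_model (i + j)).const_mul _]
  refine Finset.sum_congr rfl fun j _ ↦ ?_
  exact integral_const_mul _ _

/-! ## §2. The remainder `ρ_ab(η)/η`: bounded variation and smallness -/

/-- `∫_{y₁}^{y₂} log(1/η)^k dη/η = (log(1/y₁)^{k+1} − log(1/y₂)^{k+1})/(k+1)` for `0 < y₁ ≤ y₂`. [folklore] -/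
theorem integral_log_inv_pow_div (k : ℕ) {y₁ y₂ : ℝ} (hy₁ : 0 < y₁) (h12 : y₁ ≤ y₂) :
    ∫ η in Ioc y₁ y₂, Real.log (1 / η) ^ k / η =
      (Real.log (1 / y₁) ^ (k + 1) - Real.log (1 / y₂) ^ (k + 1)) / ((k : ℝ) + 1) := by
  rw [← intervalIntegral.integral_of_le h12]
  have h : ∫ η in y₁..y₂, Real.log (1 / η) ^ k / η = (-1) ^ k * ∫ η in y₁..y₂, Real.log η ^ k / η := by
    rw [← intervalIntegral.integral_const_mul]
    refine intervalIntegral.integral_congr fun η _ ↦ ?_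
    simp only [one_div, Real.log_inv, neg_pow (Real.log η)]
    ring
  rw [h, integral_log_pow_div k hy₁ h12, one_div, one_div, Real.log_inv, Real.log_inv, neg_pow (Real.log y₁),
    neg_pow (Real.log y₂), pow_succ (-1 : ℝ) k]
  field_simp
  ring

/-- For `0 < η ≤ y ≤ 1`, `N ≥ 1`: `(1+log(1/η))^N ≤ 2^N((1+log(1/y))^N + (2N)^N (y/η)^{1/2})`
(`log(1/η) = log(1/y) + log(y/η)`, `log(y/η) ≤ 2N·(y/η)^{1/(2N)}`). [folklore] -/
theorem one_add_log_pow_le_of_le {η y : ℝ} (hη : 0 < η) (hηy : η ≤ y) (hy1 : y ≤ 1) {N : ℕ} (hN : 1 ≤ N) :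
    (1 + Real.log (1 / η)) ^ N ≤
      2 ^ N * ((1 + Real.log (1 / y)) ^ N + (2 * (N : ℝ)) ^ N * (y / η) ^ (1 / 2 : ℝ)) := by
  have hy : 0 < y := hη.trans_le hηy
  have hLy : 0 ≤ Real.log (1 / y) := by
    rw [one_div, Real.log_inv]; have := Real.log_nonpos hy.le hy1; linarith
  set t : ℝ := Real.log (y / η) with ht
  have ht0 : 0 ≤ t := Real.log_nonneg ((one_le_div hη).2 hηy)
  have hsplit : Real.log (1 / η) = Real.log (1 / y) + t := by
    rw [ht, one_div, one_div, Real.log_inv, Real.log_inv, Real.log_div hy.ne' hη.ne']; ring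
  set X : ℝ := 1 + Real.log (1 / y) with hX
  have hX0 : 0 ≤ X := by rw [hX]; linarith
  -- `t ≤ 2N (y/η)^{1/(2N)}`, so `t^N ≤ (2N)^N (y/η)^{1/2}`
  set ε : ℝ := 1 / (2 * (N : ℝ)) with hε
  have hN0 : (0 : ℝ) < N := by exact_mod_cast hN
  have hε0 : 0 < ε := by rw [hε]; positivity
  have hyη : 0 ≤ y / η := by positivity
  have ht1 : t ≤ (2 * (N : ℝ)) * (y / η) ^ ε := by
    have h := Real.log_le_rpow_div hyη hε0
    rw [hε] at h ⊢
    calc t = Real.log (y / η) := rfl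
      _ ≤ (y / η) ^ (1 / (2 * (N : ℝ))) / (1 / (2 * (N : ℝ))) := h
      _ = (2 * (N : ℝ)) * (y / η) ^ (1 / (2 * (N : ℝ))) := by field_simp
  have htN : t ^ N ≤ (2 * (N : ℝ)) ^ N * (y / η) ^ (1 / 2 : ℝ) := by
    calc t ^ N ≤ ((2 * (N : ℝ)) * (y / η) ^ ε) ^ N := pow_le_pow_left₀ ht0 ht1 N
      _ = (2 * (N : ℝ)) ^ N * ((y / η) ^ ε) ^ N := mul_pow _ _ _
      _ = (2 * (N : ℝ)) ^ N * (y / η) ^ (1 / 2 : ℝ) := by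
          rw [← Real.rpow_natCast ((y / η) ^ ε) N, ← Real.rpow_mul hyη, hε]
          congr 2
          field_simp
  -- `(X + t)^N ≤ 2^N (X^N + t^N)`
  have hmax : (X + t) ^ N ≤ 2 ^ N * (X ^ N + t ^ N) := by
    have h1 : X + t ≤ 2 * max X t := by
      rcases le_total X t with h | h
      · rw [max_eq_right h]; linarith
      · rw [max_eq_left h]; linarith
    calc (X + t) ^ N ≤ (2 * max X t) ^ N := pow_le_pow_left₀ (by linarith) h1 N
      _ = 2 ^ N * (max X t) ^ N := mul_pow _ _ _
      _ ≤ 2 ^ N * (X ^ N + t ^ N) := by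
          gcongr
          rcases le_total X t with h | h
          · rw [max_eq_right h]; linarith [pow_nonneg hX0 N]
          · rw [max_eq_left h]; linarith [pow_nonneg ht0 N]
  rw [hsplit, ← add_assoc]
  calc (X + t) ^ N ≤ 2 ^ N * (X ^ N + t ^ N) := hmax
    _ ≤ 2 ^ N * (X ^ N + (2 * (N : ℝ)) ^ N * (y / η) ^ (1 / 2 : ℝ)) := by gcongr

/-- `∫_{0<η≤y} (y/η)^{1/2} dη = 2y` for `y > 0`, as an inequality `≤ 2y` suffices; we record the integrability and the
value. [folklore] -/
theorem integral_sqrt_div_le {y : ℝ} (hy : 0 < y) :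
    IntegrableOn (fun η : ℝ ↦ (y / η) ^ (1 / 2 : ℝ)) (Ioc 0 y) ∧ ∫ η in Ioc 0 y, (y / η) ^ (1 / 2 : ℝ) = 2 * y := by
  have hr : (-1 : ℝ) < -(1 / 2) := by norm_num
  have hint : IntervalIntegrable (fun η : ℝ ↦ η ^ (-(1 / 2) : ℝ)) volume 0 y :=
    intervalIntegral.intervalIntegrable_rpow' hr
  have hcongr : ∀ η ∈ Ioc (0 : ℝ) y, (y / η) ^ (1 / 2 : ℝ) = y ^ (1 / 2 : ℝ) * η ^ (-(1 / 2) : ℝ) := by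
    intro η hη
    rw [Real.div_rpow hy.le hη.1.le, Real.rpow_neg hη.1.le, div_eq_mul_inv]
  have hint' : IntegrableOn (fun η : ℝ ↦ y ^ (1 / 2 : ℝ) * η ^ (-(1 / 2) : ℝ)) (Ioc 0 y) := (hint.1).const_mul _
  refine ⟨hint'.congr_fun (fun η hη ↦ (hcongr η hη).symm) measurableSet_Ioc, ?_⟩
  rw [setIntegral_congr_fun measurableSet_Ioc hcongr, integral_const_mul, ← intervalIntegral.integral_of_le hy.le,
    integral_rpow (Or.inl hr)]
  have h1 : (-(1 / 2) : ℝ) + 1 = 1 / 2 := by norm_num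
  rw [h1, Real.zero_rpow (by norm_num), sub_zero]
  have h2 : y ^ (1 / 2 : ℝ) * y ^ (1 / 2 : ℝ) = y := by
    rw [← Real.rpow_add hy]; norm_num
  calc y ^ (1 / 2 : ℝ) * (y ^ (1 / 2 : ℝ) / (1 / 2)) = 2 * (y ^ (1 / 2 : ℝ) * y ^ (1 / 2 : ℝ)) := by ring
    _ = 2 * y := by rw [h2]

/-- **Bounded variation of the remainder.** With `C₁` from `shell_profile_model`: for `0 < y₁ ≤ y₂ ≤ 1`,
`|∫_{y₁<η≤y₂} (ηI_ab(η) − m_ab(η)) dη/η| ≤ C₁ (y₂ − y₁)(1+log(1/y₁))^{a+b+1}`.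
[cite: KowalskiMichelVanderKam2000, (22)–(28) — derivation (remainder of the diagonal weight, real-variable form)] -/
theorem abs_integral_shell_rem_le (a b : ℕ) : ∃ C : ℝ, ∀ y₁ y₂ : ℝ, 0 < y₁ → y₁ ≤ y₂ → y₂ ≤ 1 →
    |∫ η in Ioc y₁ y₂, (η * (∫ u in Ioi (0 : ℝ), Real.log u ^ a * Real.log (η / u) ^ b *
        (Real.exp (-(u + η / u)) / (1 - Real.exp (-(u + η / u))) ^ 2) / u) -
      ∫ v in Ioc (0 : ℝ) 1, ((-(Real.log (1 / η) / 2) + Real.log v) ^ a * (-(Real.log (1 / η) / 2) - Real.log v) ^ b +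
          (-(Real.log (1 / η) / 2) - Real.log v) ^ a * (-(Real.log (1 / η) / 2) + Real.log v) ^ b) *
        (v / (1 + v ^ 2) ^ 2)) / η| ≤ C * (y₂ - y₁) * (1 + Real.log (1 / y₁)) ^ (a + b + 1) := by
  obtain ⟨C₁, hC₁⟩ := shell_profile_model a b
  refine ⟨C₁, fun y₁ y₂ hy₁ h12 hy₂ ↦ ?_⟩
  have hC₁0 : 0 ≤ C₁ := by
    have h := hC₁ 1 one_pos le_rfl
    have : (0 : ℝ) ≤ C₁ * 1 * (1 + Real.log (1 / 1)) ^ (a + b + 1) := (abs_nonneg _).trans h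
    simpa using this
  have hL₁ : 0 ≤ Real.log (1 / y₁) := by
    rw [one_div, Real.log_inv]; have := Real.log_nonpos hy₁.le (h12.trans hy₂); linarith
  have hptw : ∀ η ∈ Ioc y₁ y₂, ‖(η * (∫ u in Ioi (0 : ℝ), Real.log u ^ a * Real.log (η / u) ^ b *
        (Real.exp (-(u + η / u)) / (1 - Real.exp (-(u + η / u))) ^ 2) / u) -
      ∫ v in Ioc (0 : ℝ) 1, ((-(Real.log (1 / η) / 2) + Real.log v) ^ a * (-(Real.log (1 / η) / 2) - Real.log v) ^ b +
          (-(Real.log (1 / η) / 2) - Real.log v) ^ a * (-(Real.log (1 / η) / 2) + Real.log v) ^ b) *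
        (v / (1 + v ^ 2) ^ 2)) / η‖ ≤ C₁ * (1 + Real.log (1 / y₁)) ^ (a + b + 1) := by
    intro η hη
    have hη0 : 0 < η := hy₁.trans hη.1
    have hη1 : η ≤ 1 := hη.2.trans hy₂
    have h := hC₁ η hη0 hη1
    have hLη : 0 ≤ Real.log (1 / η) := by
      rw [one_div, Real.log_inv]; have := Real.log_nonpos hη0.le hη1; linarith
    have hLle : Real.log (1 / η) ≤ Real.log (1 / y₁) :=
      Real.log_le_log (by positivity) (one_div_le_one_div_of_le hy₁ hη.1.le)
    rw [Real.norm_eq_abs, abs_div, abs_of_pos hη0, div_le_iff₀ hη0]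
    calc _ ≤ C₁ * η * (1 + Real.log (1 / η)) ^ (a + b + 1) := h
      _ ≤ C₁ * η * (1 + Real.log (1 / y₁)) ^ (a + b + 1) := by gcongr
      _ = C₁ * (1 + Real.log (1 / y₁)) ^ (a + b + 1) * η := by ring
  have h := norm_setIntegral_le_of_norm_le_const (μ := volume) (measure_Ioc_lt_top (a := y₁) (b := y₂)) hptw
  rw [Real.norm_eq_abs, Real.volume_real_Ioc_of_le h12] at h
  calc _ ≤ C₁ * (1 + Real.log (1 / y₁)) ^ (a + b + 1) * (y₂ - y₁) := h
    _ = C₁ * (y₂ - y₁) * (1 + Real.log (1 / y₁)) ^ (a + b + 1) := by ring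

/-- **Smallness of the remainder near `0`.** For `0 < y ≤ 1`:
`|∫_{0<η≤y} (ηI_ab(η) − m_ab(η)) dη/η| ≤ C·y·(1+log(1/y))^{a+b+1}`.
[cite: KowalskiMichelVanderKam2000, (22)–(28) — derivation (remainder of the diagonal weight, real-variable form)] -/
theorem abs_integral_shell_rem_small_le (a b : ℕ) : ∃ C : ℝ, ∀ y : ℝ, 0 < y → y ≤ 1 →
    |∫ η in Ioc 0 y, (η * (∫ u in Ioi (0 : ℝ), Real.log u ^ a * Real.log (η / u) ^ b *
        (Real.exp (-(u + η / u)) / (1 - Real.exp (-(u + η / u))) ^ 2) / u) -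
      ∫ v in Ioc (0 : ℝ) 1, ((-(Real.log (1 / η) / 2) + Real.log v) ^ a * (-(Real.log (1 / η) / 2) - Real.log v) ^ b +
          (-(Real.log (1 / η) / 2) - Real.log v) ^ a * (-(Real.log (1 / η) / 2) + Real.log v) ^ b) *
        (v / (1 + v ^ 2) ^ 2)) / η| ≤ C * y * (1 + Real.log (1 / y)) ^ (a + b + 1) := by
  obtain ⟨C₁, hC₁⟩ := shell_profile_model a b
  have hC₁0 : 0 ≤ C₁ := by
    have h := hC₁ 1 one_pos le_rfl
    have : (0 : ℝ) ≤ C₁ * 1 * (1 + Real.log (1 / 1)) ^ (a + b + 1) := (abs_nonneg _).trans h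
    simpa using this
  set N : ℕ := a + b + 1 with hN
  have hN1 : 1 ≤ N := by omega
  set K : ℝ := (2 * (N : ℝ)) ^ N with hK
  refine ⟨C₁ * 2 ^ N * (1 + 2 * K), fun y hy0 hy1 ↦ ?_⟩
  set Ly : ℝ := Real.log (1 / y) with hLy
  have hLy0 : 0 ≤ Ly := by rw [hLy, one_div, Real.log_inv]; have := Real.log_nonpos hy0.le hy1; linarith
  obtain ⟨hsq_int, hsq_val⟩ := integral_sqrt_div_le hy0
  -- the dominating function
  set g : ℝ → ℝ := fun η ↦ C₁ * 2 ^ N * (1 + Ly) ^ N + C₁ * 2 ^ N * K * (y / η) ^ (1 / 2 : ℝ) with hg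
  have hg_int : IntegrableOn g (Ioc 0 y) := by
    refine IntegrableOn.add ?_ (hsq_int.const_mul _)
    exact (integrableOn_const_iff (C := C₁ * 2 ^ N * (1 + Ly) ^ N)).2 (Or.inr (measure_Ioc_lt_top))
  have hg_val : ∫ η in Ioc 0 y, g η = C₁ * 2 ^ N * (1 + Ly) ^ N * y + C₁ * 2 ^ N * K * (2 * y) := by
    simp only [hg]
    have h1 : ∫ η in Ioc 0 y, C₁ * 2 ^ N * (1 + Ly) ^ N = C₁ * 2 ^ N * (1 + Ly) ^ N * y := by
      rw [setIntegral_const, Real.volume_real_Ioc_of_le hy0.le, sub_zero, smul_eq_mul]; ring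
    have h2 : ∫ η in Ioc 0 y, C₁ * 2 ^ N * K * (y / η) ^ (1 / 2 : ℝ) = C₁ * 2 ^ N * K * (2 * y) := by
      rw [integral_const_mul, hsq_val]
    rw [integral_add ((integrableOn_const_iff (C := C₁ * 2 ^ N * (1 + Ly) ^ N)).2 (Or.inr (measure_Ioc_lt_top)))
      (hsq_int.const_mul _), h1, h2]
  have hptw : ∀ᵐ η ∂(volume.restrict (Ioc 0 y)), ‖(η * (∫ u in Ioi (0 : ℝ), Real.log u ^ a * Real.log (η / u) ^ b *
        (Real.exp (-(u + η / u)) / (1 - Real.exp (-(u + η / u))) ^ 2) / u) -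
      ∫ v in Ioc (0 : ℝ) 1, ((-(Real.log (1 / η) / 2) + Real.log v) ^ a * (-(Real.log (1 / η) / 2) - Real.log v) ^ b +
          (-(Real.log (1 / η) / 2) - Real.log v) ^ a * (-(Real.log (1 / η) / 2) + Real.log v) ^ b) *
        (v / (1 + v ^ 2) ^ 2)) / η‖ ≤ g η := by
    rw [ae_restrict_iff' measurableSet_Ioc]
    refine ae_of_all _ fun η hη ↦ ?_
    have hη0 : 0 < η := hη.1
    have hη1 : η ≤ 1 := hη.2.trans hy1
    have h := hC₁ η hη0 hη1
    have hlog := one_add_log_pow_le_of_le hη0 hη.2 hy1 hN1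
    rw [Real.norm_eq_abs, abs_div, abs_of_pos hη0, div_le_iff₀ hη0]
    calc _ ≤ C₁ * η * (1 + Real.log (1 / η)) ^ N := h
      _ ≤ C₁ * η * (2 ^ N * ((1 + Ly) ^ N + (2 * (N : ℝ)) ^ N * (y / η) ^ (1 / 2 : ℝ))) := by gcongr
      _ = g η * η := by simp only [hg, hK]; ring
  have h := norm_integral_le_of_norm_le hg_int hptw
  rw [Real.norm_eq_abs, hg_val] at h
  refine h.trans ?_
  have hX1 : 1 ≤ (1 + Ly) ^ N := one_le_pow₀ (by linarith)
  have : C₁ * 2 ^ N * K * (2 * y) ≤ C₁ * 2 ^ N * K * (2 * y) * (1 + Ly) ^ N :=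
    le_mul_of_one_le_right (by positivity) hX1
  nlinarith [this]

end Summit.Parity.GeneralizedHardyLittlewood.Theorems.MomentsBeyondDiagonal.DiagLines

end
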